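import Literature.Computability.QuantumComplexity.PolyCopiesIdx
import Literature.Probability.Distributions.IndepProductLaw
import HarnessLib

/-!
# Polynomially many parallel indexed copies of a uniform quantum circuit family, III: the output law

Topic `Literature/Computability/QuantumComplexity`; sequel of `PolyCopiesIdx.lean` (block
`j < K(n)` runs the given family `F` on the basis input `x ++ e_j`; the final state is the product
state `stageQ_mulVec_W1`). This file reads the **joint law of the measured block contents**: the
`K(|x|)` segments of the output string that carry the wires of the copies are INDEPENDENT, the
`j`-th one having the law of the output of `F` on the input `x ++ e_j` — the measurement statistics
of a product state (Nielsen–Chuang 2010, §2.2.8; Bennett–Bernstein–Brassard–Vazirani 1997, proof of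
Thm. 4.13: "this is just like taking … `k` independent" runs). In `PMF` form:

* `PolyCopiesIdx.segment` — the measured content of copy `j` read off the output string
  (`drop (blk j 0)`, `take (nIn + F.ancillas nIn)`); `segment_ofFn`;
* `PolyCopiesIdx.blockLaw x j` — the output law of `F` run on `x ++ e_j`, and
  `blockLaw_eq_kernel : blockLaw x j = F.kernel (inputIdx x j)` (transport along the propositional
  length identity `|x ++ e_j| = nIn |x|`, `QCircuitFamily.kernel_eq_map_outputPMF`);
* `PolyCopiesIdx.kernel_map_segments` — **the law of the tuple of segments under the family's
  kernel is the independent product `indepLaw (K |x|) (blockLaw x)`** (`IndepProductLaw.lean`);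
* `PolyCopiesIdx.kernelProb_segments_pi` — in particular product events have product
  probabilities.

## References

* M. A. Nielsen, I. L. Chuang, *Quantum Computation and Quantum Information*, CUP 2010, §2.2.5,
  §2.2.8 (measurement statistics of product states) [NielsenChuang2010].
* C. H. Bennett, E. Bernstein, G. Brassard, U. Vazirani, *Strengths and weaknesses of quantum
  computing*, SIAM J. Comput. 26 (1997) 1510–1523, Thm. 4.13–4.14 (proofs) [BennettBernsteinBrassardVazirani1997].
-/

noncomputable section

namespace Literature.Computability.QuantumComplexity

open _root_.Computability Complexity Cryptography Matrix Finset Literature.Probability.Distributions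

/-! ### The kernel of a family at a string, as the output law at a register -/

/-- **The kernel at a string `xs` of length `m` is the output law of `F.circ m` on the register
reading `xs`** (transport along a propositional length identity: `subst`). [folklore] -/
theorem QCircuitFamily.kernel_eq_map_outputPMF (F : QCircuitFamily cliffordT) (xs : List Bool) {m : ℕ}
    (h : xs.length = m) (v : QReg m) (hv : ∀ i, xs.get i = v (Fin.cast h i)) :
    F.kernel 0 xs = ((F.circ m).outputPMF 0 v).map List.ofFn := by
  subst h
  have e : v = xs.get := funext fun i => (hv i).symm
  subst e
  rfl

namespace PolyCopiesIdx

variable (P : PolyCopies.Params)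

/-! ### Segments of the output string -/

/-- **The measured content of copy `j`**, read off the output string `w` of the family on an input of
length `n`: the `nIn n + F.ancillas (nIn n)` bits starting at position `blk n j 0`. [folklore] -/
def segment (n : ℕ) (w : List Bool) (j : ℕ) : List Bool :=
  (w.drop (blk P n j 0)).take (nIn P n + P.F.ancillas (nIn P n))

/-- **The output law of copy `j`**: the given family run on the register `x ++ e_j`, measured on all
its wires. [cite: NielsenChuang2010, §2.2.5 (Born rule)] -/
def blockLaw (x : List Bool) (j : ℕ) : PMF (List Bool) :=
  ((P.F.circ (nIn P x.length)).outputPMF 0 (inIdx P x j)).map List.ofFn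

variable {P}

/-- **The segment of a measured register is the restriction to the wires of the copy.** [folklore] -/
theorem segment_ofFn (x : List Bool) (z : QReg (x.length + anc P x.length)) (j : Fin (K P x.length)) :
    segment P x.length (List.ofFn z) j =
      List.ofFn ((z ∘ blockEmb P x.length j) ∘ Fin.castLEEmb (copy_fits x.length)) := by
  have hfit : blk P x.length j 0 + (nIn P x.length + P.F.ancillas (nIn P x.length)) ≤ x.length + anc P x.length := by
    have h1 := blk_lt_W (P := P) j.isLt (b_pos x.length)
    have h2 : blk P x.length j 0 + b P x.length ≤ W P x.length := by
      have := blk_lt_W (P := P) j.isLt (show b P x.length - 1 < b P x.length by have := b_pos (P := P) x.length; omega)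
      rw [blk_eq_add _ j (b P x.length - 1)] at this
      omega
    have h3 := copy_fits (P := P) x.length
    rw [n_add_anc]; omega
  unfold segment
  apply List.ext_getElem
  · rw [List.length_take, List.length_drop, List.length_ofFn, List.length_ofFn]
    exact Nat.min_eq_left (by omega)
  · intro i hi hi'
    rw [List.length_ofFn] at hi'
    rw [List.getElem_take, List.getElem_drop, List.getElem_ofFn, List.getElem_ofFn]
    simp only [Function.comp_apply]
    congr 1

/-- `blockLaw x j` IS the kernel of the given family at the string `x ++ e_j`. [folklore] -/
theorem blockLaw_eq_kernel (x : List Bool) (j : ℕ) : blockLaw P x j = P.F.kernel 0 (inputIdx P x j) :=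
  (QCircuitFamily.kernel_eq_map_outputPMF P.F (inputIdx P x j) (length_inputIdx j) (inIdx P x j) (get_inputIdx j)).symm

/-- The mass of a singleton under `blockLaw`, as a Born sum. [cite: NielsenChuang2010, §2.2.5 (Born rule)] -/
theorem toReal_blockLaw_apply (x : List Bool) (j : ℕ) (y : List Bool) :
    (blockLaw P x j y).toReal = ∑ u : QReg (nIn P x.length + P.F.ancillas (nIn P x.length)),
      if List.ofFn u = y then
        ‖((P.F.circ (nIn P x.length)).runOn 0 (basisState (padInput (inIdx P x j) (P.F.ancillas (nIn P x.length))))) u‖ ^ 2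
      else 0 := by
  classical
  rw [blockLaw, ← PMF.toOuterMeasure_apply_singleton, toReal_outputPMF_map_ofFn]
  exact Finset.sum_congr rfl fun u _ => by simp only [Set.mem_singleton_iff]

/-! ### The product law -/

/-- **The law of the tuple of segments is the independent product of the block laws.** Under the
kernel of the indexed-copies family on `x`, the `K(|x|)` measured copy contents are independent, the
`j`-th having law `blockLaw x j` (= the kernel of `F` at `x ++ e_j`): the Born weights of the product
state factor over the blocks (`sum_normSq_prodState_mul`), and each block factor is the one-block
marginal `sum_ite_normSq_blockState`. [cite: NielsenChuang2010, §2.2.8 (measurement statistics of a product state)] -/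
theorem kernel_map_segments (x : List Bool) :
    ((family P).kernel 0 x).map (fun w => fun j : Fin (K P x.length) => segment P x.length w j) =
      indepLaw (K P x.length) (fun j => blockLaw P x j) := by
  classical
  refine indepLaw_eq_of_apply _ _ fun y => ?_
  -- both sides are finite; compare real parts
  have hL : (((family P).kernel 0 x).map (fun w => fun j : Fin (K P x.length) => segment P x.length w j)) y =
      ((family P).kernel 0 x).toOuterMeasure {w | (fun j : Fin (K P x.length) => segment P x.length w j) = y} := by
    rw [← PMF.toOuterMeasure_apply_singleton, PMF.toOuterMeasure_map_apply]
    rfl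
  have hLtop : ((family P).kernel 0 x).toOuterMeasure {w | (fun j : Fin (K P x.length) => segment P x.length w j) = y} ≠ ⊤ :=
    ne_top_of_le_ne_top ENNReal.one_ne_top
      ((PMF.toOuterMeasure_mono _ (Set.subset_univ _)).trans_eq ((PMF.toOuterMeasure_apply_eq_one_iff _ _).2 (Set.subset_univ _)))
  have hRtop : ∀ j : Fin (K P x.length), blockLaw P x j (y j) ≠ ⊤ := fun j => PMF.apply_ne_top _ _
  rw [hL, ← ENNReal.toReal_eq_toReal_iff' hLtop (ENNReal.prod_ne_top fun j _ => hRtop j), ENNReal.toReal_prod]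
  -- the left side as a Born sum
  have hK := kernelProb_family_eq (P := P) x {w | (fun j : Fin (K P x.length) => segment P x.length w j) = y}
  change (family P).kernelProb 0 x {w | (fun j : Fin (K P x.length) => segment P x.length w j) = y} = _ at hK ⊢
  rw [hK]
  -- the indicator is a function of the block contents
  let g : (Fin (K P x.length) → QReg (b P x.length)) → ℝ := fun yb =>
    ∏ j, if List.ofFn (yb j ∘ Fin.castLEEmb (copy_fits x.length)) = y j then (1 : ℝ) else 0
  have hind : ∀ z : QReg (x.length + anc P x.length),
      (if List.ofFn z ∈ {w | (fun j : Fin (K P x.length) => segment P x.length w j) = y} then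
        ‖prodState (blockEmb P x.length) (fun j => blockState P x j) (W1 P x) z‖ ^ 2 else 0) =
      ‖prodState (blockEmb P x.length) (fun j => blockState P x j) (W1 P x) z‖ ^ 2 * g (fun j => z ∘ blockEmb P x.length j) := by
    intro z
    have hiff : List.ofFn z ∈ {w | (fun j : Fin (K P x.length) => segment P x.length w j) = y} ↔
        ∀ j : Fin (K P x.length), List.ofFn ((z ∘ blockEmb P x.length j) ∘ Fin.castLEEmb (copy_fits x.length)) = y j := by
      simp only [Set.mem_setOf_eq, funext_iff, segment_ofFn]
    simp only [g, Finset.prod_boole, Finset.mem_univ, forall_true_left]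
    by_cases h : ∀ j : Fin (K P x.length), List.ofFn ((z ∘ blockEmb P x.length j) ∘ Fin.castLEEmb (copy_fits x.length)) = y j
    · rw [if_pos (hiff.2 h), if_pos h, mul_one]
    · rw [if_neg (fun h' => h (hiff.1 h')), if_neg h, mul_zero]
  rw [Finset.sum_congr rfl fun z _ => hind z,
    sum_normSq_prodState_mul blockDisjoint (fun j => blockState P x j) (W1 P x) g]
  -- factor over the blocks
  have hterm : ∀ yb : Fin (K P x.length) → QReg (b P x.length),
      (∏ j : Fin (K P x.length), ‖blockState P x j (yb j)‖ ^ 2) * g yb =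
        ∏ j : Fin (K P x.length),
          (if List.ofFn (yb j ∘ Fin.castLEEmb (copy_fits x.length)) = y j then ‖blockState P x j (yb j)‖ ^ 2 else 0) := by
    intro yb
    rw [← Finset.prod_mul_distrib]
    refine Finset.prod_congr rfl fun j _ => ?_
    split_ifs <;> simp
  simp_rw [hterm]
  have hps := Finset.prod_univ_sum (fun _ : Fin (K P x.length) => (Finset.univ : Finset (QReg (b P x.length))))
    (fun (j : Fin (K P x.length)) v =>
      if List.ofFn (v ∘ Fin.castLEEmb (copy_fits x.length)) = y j then ‖blockState P x j v‖ ^ 2 else 0)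
  rw [Fintype.piFinset_univ] at hps
  rw [← hps]
  -- each factor is the block law
  refine Finset.prod_congr rfl fun j _ => ?_
  rw [sum_ite_normSq_blockState x j (fun u => List.ofFn u = y j), toReal_blockLaw_apply]

/-- **Product events have product probabilities**: under the indexed-copies family on `x`,
`Pr[∀ j, segment j ∈ A j] = ∏ⱼ blockLaw x j (A j)`. [cite: NielsenChuang2010, §2.2.8 (measurement statistics of a product state)] -/
theorem kernel_toOuterMeasure_segments_pi (x : List Bool) (A : Fin (K P x.length) → Set (List Bool)) :
    ((family P).kernel 0 x).toOuterMeasure {w | ∀ j : Fin (K P x.length), segment P x.length w j ∈ A j} =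
      ∏ j : Fin (K P x.length), (blockLaw P x j).toOuterMeasure (A j) := by
  rw [← toOuterMeasure_indepLaw_pi, ← kernel_map_segments, PMF.toOuterMeasure_map_apply]
  rfl

end PolyCopiesIdx

end Literature.Computability.QuantumComplexity

end
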